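import Mathlib
import HarnessLib
import Literature.Analysis.FluidPDE.SuitableWeak
import Literature.Analysis.FluidPDE.LerayHopf
import Literature.Analysis.FluidPDE.VectorCalculus
import Summits.NavierStokesRegularity.NavierStokesRegularity.Theses.QuarterJolt
import Summits.NavierStokesRegularity.NavierStokesRegularity.Theorems.LerayQuarterDissipationRecordTimeTypeI

/-!
# Route QuarterJolt — support `JoltFlatCell` (stmt-NavierStokesRegularity-26464):
# no terminal jolt + the quarter slice law ⇒ the scaled kinetic energy of every parabolic cell vanishes

Seat ns-qj-p1 g0 (director-ns g13 req142 (2)); planner of record ns-idea-9 g2 (route header §«#9 JoltFlatCell»,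
critic idea-crit-8 V25, price P2).

THE STATEMENT (`…Theses.QuarterJolt.JoltFlatCell`, proved here BY NAME as `joltFlatCell_proof`): in the frame
(classical on `[0,T)`, Leray–Hopf on `[0,T]`, rapidly decaying datum), the slice law
`∫|curl u(t)|² ≤ K/√(T−t)` on `[0,T)` together with NO TERMINAL JOLT
`(√(T−t))⁻¹ · ∫|u(t)−u(T)|² → 0` (`t ↑ T`) give, at EVERY point `x₀` and for every `ε > 0`, a radius `r₀ > 0`
with `∫_{B_r(x₀)} |u(t)|² ≤ ε r` for all `0 < r < r₀` and all `t ∈ (T − r², T]`.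

PROOF (the planner's two-triangle plan).
1. `RecordTimeTypeI.main` (item 22145, landed): the slice law forces the velocity Type-I rate,
   `‖u(t,x)‖ ≤ C/√(T−t)` for `t` near `T`.
2. With `s = T − θr²`: `∫_{B_r}|u(T)|² ≤ 2‖u(T)−u(s)‖₂² + 2∫_{B_r}|u(s)|² ≤ 2 D(s)·√θ·r + 2 C²|B₁| r/θ`, where
   `D(s) = (√(T−s))⁻¹‖u(s)−u(T)‖₂²` is the jolt functional.
3. For `t ∈ (T−r², T)`: `∫_{B_r}|u(t)|² ≤ 2‖u(t)−u(T)‖₂² + 2∫_{B_r}|u(T)|² ≤ 2 D(t) r + 2·(step 2)`.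
4. Choose `θ ≥ max(1, 16 C²|B₁|/ε)`, then `δ = ε/(16√θ)` and `r₀ = √((T−T₁)/θ)` where on `(T₁, T)` both the Type-I bound
   and `D < δ` hold: the total is `≤ (2δ + 4δ√θ + 4C²|B₁|/θ)·r ≤ ε r`.
All slices `u(t)`, `t ∈ [0,T]`, are in `L²` (`IsLerayHopfOn.memLp`), so the Bochner integrals in the jolt functional are honest
and convert to lower Lebesgue integrals (`eEnergy_eq_ofReal`).

WHAT THIS IS NOT: not a proof of Navier–Stokes regularity and not progress on the route's two OPEN cruxes
(`EnstrophyQuarterLaw` stmt-1574, `NoTerminalJolt` stmt-26463 — both consequences of regularity used toward it); it is the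
unconditional M− support turning the jolt law into Morrey flatness of the kinetic energy at the terminal time.
No summit statement is proved here. [folklore]
-/

noncomputable section

-- the summit and its single sub-problem share the name (CONVENTIONS §1), as in every Theorems file
set_option linter.dupNamespace false

namespace Summit.NavierStokesRegularity.NavierStokesRegularity.Theorems

open MeasureTheory Set Function Filter Topology Metric
open scoped NNReal ENNReal
open Literature.Analysis.FluidPDE

namespace JoltFlatCell

/-- For an `L²` field the lower Lebesgue integral of `‖f‖²` is the honest Bochner integral:
`∫⁻ ‖f‖ₑ² = ofReal (∫ ‖f‖²)` (the tree's `eEnergy_eq_ofReal`, unfolded). -/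
theorem lintegral_enorm_sq_eq_ofReal {f : EuclideanSpace ℝ (Fin 3) → EuclideanSpace ℝ (Fin 3)}
    (hf : MemLp f 2 volume) : ∫⁻ x, ‖f x‖ₑ ^ 2 = ENNReal.ofReal (∫ x, ‖f x‖ ^ 2) := by
  have h := eEnergy_eq_ofReal f hf
  rw [eEnergy, VectorCalculus.kineticEnergy, ← mul_assoc, mul_inv_cancel₀ two_ne_zero, one_mul] at h
  exact h

/-- Pointwise two-term inequality `‖a‖² ≤ 2‖a − b‖² + 2‖b‖²` in `ℝ≥0∞`. -/
theorem enorm_sq_le_two_mul (a b : EuclideanSpace ℝ (Fin 3)) :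
    ‖a‖ₑ ^ 2 ≤ 2 * ‖a - b‖ₑ ^ 2 + 2 * ‖b‖ₑ ^ 2 := by
  have h1 : ‖a‖ ≤ ‖a - b‖ + ‖b‖ := by simpa using norm_add_le (a - b) b
  have h1' := mul_le_mul h1 h1 (norm_nonneg a) (add_nonneg (norm_nonneg _) (norm_nonneg _))
  have h2 : ‖a‖ ^ 2 ≤ 2 * ‖a - b‖ ^ 2 + 2 * ‖b‖ ^ 2 := by
    nlinarith [sq_nonneg (‖a - b‖ - ‖b‖), norm_nonneg a, norm_nonneg (a - b), norm_nonneg b]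
  calc ‖a‖ₑ ^ 2 = ENNReal.ofReal (‖a‖ ^ 2) := by
        rw [← ofReal_norm, ENNReal.ofReal_pow (norm_nonneg _)]
    _ ≤ ENNReal.ofReal (2 * ‖a - b‖ ^ 2 + 2 * ‖b‖ ^ 2) := ENNReal.ofReal_le_ofReal h2
    _ = 2 * ‖a - b‖ₑ ^ 2 + 2 * ‖b‖ₑ ^ 2 := by
        rw [ENNReal.ofReal_add (by positivity) (by positivity), ENNReal.ofReal_mul zero_le_two,
          ENNReal.ofReal_mul zero_le_two, ENNReal.ofReal_pow (norm_nonneg _),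
          ENNReal.ofReal_pow (norm_nonneg _), ofReal_norm, ofReal_norm,
          ENNReal.ofReal_ofNat]

/-- The two-term inequality integrated over a set: `∫_S ‖f‖² ≤ 2∫_S ‖f − g‖² + 2∫_S ‖g‖²`
(lower Lebesgue integrals; `g` a.e.-strongly measurable). -/
theorem setLIntegral_enorm_sq_le {f g : EuclideanSpace ℝ (Fin 3) → EuclideanSpace ℝ (Fin 3)}
    (hg : AEStronglyMeasurable g volume) (S : Set (EuclideanSpace ℝ (Fin 3))) :
    ∫⁻ x in S, ‖f x‖ₑ ^ 2 ≤ 2 * (∫⁻ x in S, ‖f x - g x‖ₑ ^ 2) + 2 * ∫⁻ x in S, ‖g x‖ₑ ^ 2 := by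
  calc ∫⁻ x in S, ‖f x‖ₑ ^ 2 ≤ ∫⁻ x in S, (2 * ‖f x - g x‖ₑ ^ 2 + 2 * ‖g x‖ₑ ^ 2) :=
        lintegral_mono fun x => enorm_sq_le_two_mul (f x) (g x)
    _ = (∫⁻ x in S, 2 * ‖f x - g x‖ₑ ^ 2) + ∫⁻ x in S, 2 * ‖g x‖ₑ ^ 2 :=
        lintegral_add_right' _ ((hg.enorm.pow_const 2).const_mul 2).restrict
    _ = 2 * (∫⁻ x in S, ‖f x - g x‖ₑ ^ 2) + 2 * ∫⁻ x in S, ‖g x‖ₑ ^ 2 := by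
        rw [lintegral_const_mul' _ _ ENNReal.ofNat_ne_top, lintegral_const_mul' _ _ ENNReal.ofNat_ne_top]

/-- A pointwise bound `‖f‖² ≤ A` on a ball of radius `r` integrates to `A · r³ · |B₁|`. -/
theorem setLIntegral_ball_le_of_bound {f : EuclideanSpace ℝ (Fin 3) → EuclideanSpace ℝ (Fin 3)}
    {x₀ : EuclideanSpace ℝ (Fin 3)} {r A V : ℝ} (hr : 0 < r) (hA : 0 ≤ A)
    (hV : volume (ball (0 : EuclideanSpace ℝ (Fin 3)) 1) = ENNReal.ofReal V)
    (hf : ∀ x, ‖f x‖ ^ 2 ≤ A) :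
    ∫⁻ x in ball x₀ r, ‖f x‖ₑ ^ 2 ≤ ENNReal.ofReal (A * r ^ 3 * V) := by
  calc ∫⁻ x in ball x₀ r, ‖f x‖ₑ ^ 2 ≤ ∫⁻ _ in ball x₀ r, ENNReal.ofReal A := by
        refine lintegral_mono fun x => ?_
        rw [← ofReal_norm, ← ENNReal.ofReal_pow (norm_nonneg _)]
        exact ENNReal.ofReal_le_ofReal (hf x)
    _ = ENNReal.ofReal A * volume (ball x₀ r) := setLIntegral_const _ _
    _ = ENNReal.ofReal (A * r ^ 3 * V) := by
        rw [Measure.addHaar_ball volume x₀ hr.le, finrank_euclideanSpace_fin, hV,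
          ← ENNReal.ofReal_mul (by positivity), ← ENNReal.ofReal_mul (by positivity), mul_assoc]

/-- `ℝ≥0∞` bookkeeping: `2·ofReal a + 2·ofReal b = ofReal (2a + 2b)` for `a, b ≥ 0`. -/
theorem two_mul_ofReal_add {a b : ℝ} (ha : 0 ≤ a) (hb : 0 ≤ b) :
    2 * ENNReal.ofReal a + 2 * ENNReal.ofReal b = ENNReal.ofReal (2 * a + 2 * b) := by
  rw [ENNReal.ofReal_add (by positivity) (by positivity), ENNReal.ofReal_mul zero_le_two,
    ENNReal.ofReal_mul zero_le_two, ENNReal.ofReal_ofNat]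

/-- **JoltFlatCell, hypothesis form.** In the frame, the slice law (constant `K`) and no terminal jolt give at every `x₀`
a vanishing scaled cell energy: `∀ ε > 0 ∃ r₀ > 0 ∀ r ∈ (0,r₀) ∀ t ∈ (T−r², T]: ∫_{B_r(x₀)} |u(t)|² ≤ ε r`.
Type I from `RecordTimeTypeI.main`, then two triangle inequalities through `u(T)`. [folklore] -/
theorem main {ν T : ℝ} (hν : 0 < ν) (hT : 0 < T)
    {u : ℝ → EuclideanSpace ℝ (Fin 3) → EuclideanSpace ℝ (Fin 3)} {p : ℝ → EuclideanSpace ℝ (Fin 3) → ℝ}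
    (hsol : IsClassicalNSSolutionOn (Ico 0 T) ν 0 u p) (hLH : IsLerayHopfOn T ν 0 (u 0) u)
    (hdec : HasRapidSpatialDecay (u 0)) (K : ℝ)
    (hK : ∀ t ∈ Ico 0 T, ∫⁻ x, ‖curl (u t) x‖ₑ ^ 2 ≤ ENNReal.ofReal (K / Real.sqrt (T - t)))
    (hJ : Tendsto (fun t : ℝ => (Real.sqrt (T - t))⁻¹ * ∫ x, ‖u t x - u T x‖ ^ 2) (𝓝[<] T) (𝓝 0))
    (x₀ : EuclideanSpace ℝ (Fin 3)) {ε : ℝ} (hε : 0 < ε) :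
    ∃ r₀ : ℝ, 0 < r₀ ∧ ∀ r : ℝ, 0 < r → r < r₀ → ∀ t ∈ Ioc (T - r ^ 2) T,
      ∫⁻ x in ball x₀ r, ‖u t x‖ₑ ^ 2 ≤ ENNReal.ofReal (ε * r) := by
  -- Step 1: the velocity Type-I rate from the slice law (item 22145)
  obtain ⟨C, hC⟩ := RecordTimeTypeI.main hν hT hsol hLH hdec K hK
  -- the volume of the unit ball as a real number
  obtain ⟨V, hV0, hV⟩ : ∃ V : ℝ, 0 ≤ V ∧ volume (ball (0 : EuclideanSpace ℝ (Fin 3)) 1) = ENNReal.ofReal V :=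
    ⟨_, ENNReal.toReal_nonneg, (ENNReal.ofReal_toReal measure_ball_lt_top.ne).symm⟩
  -- the depth parameter `θ` and the jolt threshold `δ`
  obtain ⟨θ, hθ1, hθε⟩ : ∃ θ : ℝ, 1 ≤ θ ∧ 4 * C ^ 2 * V / θ ≤ ε / 4 := by
    refine ⟨max 1 (16 * C ^ 2 * V / ε), le_max_left _ _, ?_⟩
    have hθ0 : 0 < max 1 (16 * C ^ 2 * V / ε) := lt_of_lt_of_le one_pos (le_max_left _ _)
    have h' : 16 * C ^ 2 * V ≤ max 1 (16 * C ^ 2 * V / ε) * ε := (div_le_iff₀ hε).1 (le_max_right _ _)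
    rw [div_le_iff₀ hθ0]
    linarith
  have hθ0 : 0 < θ := by linarith
  have hsθ : 1 ≤ Real.sqrt θ := Real.one_le_sqrt.2 hθ1
  have hsθ0 : 0 < Real.sqrt θ := by linarith
  -- the Type-I cell constant `W = C²|B₁|/θ`
  obtain ⟨W, hW0, hWε, hWdef⟩ : ∃ W : ℝ, 0 ≤ W ∧ 4 * W ≤ ε / 4 ∧ W = C ^ 2 * V / θ :=
    ⟨C ^ 2 * V / θ, by positivity, by
      have h : 4 * (C ^ 2 * V / θ) = 4 * C ^ 2 * V / θ := by ring
      rw [h]; exact hθε, rfl⟩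
  obtain ⟨δ, hδ0, hδ1, hδ2⟩ : ∃ δ : ℝ, 0 < δ ∧ 4 * δ * Real.sqrt θ = ε / 4 ∧ 2 * δ ≤ ε / 8 := by
    refine ⟨ε / (16 * Real.sqrt θ), by positivity, ?_, ?_⟩
    · field_simp
      ring
    · have h : 2 * (ε / (16 * Real.sqrt θ)) = ε / (8 * Real.sqrt θ) := by
        field_simp
        ring
      rw [h]
      exact div_le_div_of_nonneg_left hε.le (by norm_num) (by linarith)
  -- Step 2: the window `(T₁, T)` on which the Type-I bound and `D < δ` hold
  have h2 : ∀ᶠ t in 𝓝[<] T, (Real.sqrt (T - t))⁻¹ * ∫ x, ‖u t x - u T x‖ ^ 2 < δ :=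
    hJ.eventually (Iio_mem_nhds hδ0)
  have h3 : ∀ᶠ t in 𝓝[<] T, t ∈ Ioo 0 T := Ioo_mem_nhdsLT hT
  obtain ⟨T₁, hT₁T, hT₁⟩ := mem_nhdsLT_iff_exists_Ioo_subset.1 (hC.and (h2.and h3))
  have hT₁T' : T₁ < T := hT₁T
  -- the radius
  refine ⟨Real.sqrt ((T - T₁) / θ), Real.sqrt_pos.2 (div_pos (sub_pos.2 hT₁T') hθ0), ?_⟩
  intro r hr hrr₀ t ht
  have hθr : θ * r ^ 2 < T - T₁ := by
    have h := pow_lt_pow_left₀ hrr₀ hr.le two_ne_zero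
    rw [Real.sq_sqrt (div_pos (sub_pos.2 hT₁T') hθ0).le, lt_div_iff₀ hθ0] at h
    linarith
  -- the earlier time `s = T - θ r²`
  set s : ℝ := T - θ * r ^ 2 with hs
  have hr2 : 0 < θ * r ^ 2 := by positivity
  have hsI : s ∈ Ioo T₁ T := ⟨by rw [hs]; linarith, by rw [hs]; linarith⟩
  obtain ⟨hCs, hDs, hs0T⟩ := hT₁ hsI
  have hTs : T - s = θ * r ^ 2 := by rw [hs]; ring
  have hsqTs : Real.sqrt (T - s) = Real.sqrt θ * r := by
    rw [hTs, Real.sqrt_mul hθ0.le, Real.sqrt_sq hr.le]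
  have hsq0 : 0 < Real.sqrt (T - s) := by rw [hsqTs]; positivity
  have hmT : MemLp (u T) 2 volume := hLH.memLp T ⟨hT.le, le_rfl⟩
  have hms : MemLp (u s) 2 volume := hLH.memLp s ⟨hs0T.1.le, hs0T.2.le⟩
  -- (a) the Type-I cell bound at time `s`
  have hA : ∫⁻ x in ball x₀ r, ‖u s x‖ₑ ^ 2 ≤ ENNReal.ofReal (C ^ 2 / (θ * r ^ 2) * r ^ 3 * V) := by
    refine setLIntegral_ball_le_of_bound hr (by positivity) hV fun x => ?_
    have hx := hCs x
    calc ‖u s x‖ ^ 2 ≤ (C / Real.sqrt (T - s)) ^ 2 := pow_le_pow_left₀ (norm_nonneg _) hx 2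
      _ = C ^ 2 / (θ * r ^ 2) := by rw [div_pow, Real.sq_sqrt (by rw [hTs]; positivity), hTs]
  -- (b) the jolt bound at time `s`: `‖u(T) − u(s)‖₂² ≤ δ √θ r`
  have hI_s : ∫ x, ‖u T x - u s x‖ ^ 2 ≤ δ * (Real.sqrt θ * r) := by
    have h := mul_lt_mul_of_pos_left hDs hsq0
    rw [← mul_assoc, mul_inv_cancel₀ hsq0.ne', one_mul, hsqTs] at h
    have h' : (∫ x, ‖u T x - u s x‖ ^ 2) = ∫ x, ‖u s x - u T x‖ ^ 2 := by
      simp_rw [norm_sub_rev (u T _) (u s _)]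
    rw [h', mul_comm (Real.sqrt θ * r) δ] at *
    exact h.le
  have hL_s : ∫⁻ x, ‖u T x - u s x‖ₑ ^ 2 ≤ ENNReal.ofReal (δ * (Real.sqrt θ * r)) := by
    rw [lintegral_enorm_sq_eq_ofReal (f := fun x => u T x - u s x) (hmT.sub hms)]
    exact ENNReal.ofReal_le_ofReal hI_s
  -- (c) the cell energy at the terminal time
  have hB : ∫⁻ x in ball x₀ r, ‖u T x‖ₑ ^ 2 ≤ ENNReal.ofReal ((2 * δ * Real.sqrt θ + 2 * W) * r) := by
    calc ∫⁻ x in ball x₀ r, ‖u T x‖ₑ ^ 2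
        ≤ 2 * (∫⁻ x in ball x₀ r, ‖u T x - u s x‖ₑ ^ 2) + 2 * ∫⁻ x in ball x₀ r, ‖u s x‖ₑ ^ 2 :=
          setLIntegral_enorm_sq_le hms.1 _
      _ ≤ 2 * ENNReal.ofReal (δ * (Real.sqrt θ * r)) + 2 * ENNReal.ofReal (C ^ 2 / (θ * r ^ 2) * r ^ 3 * V) :=
          add_le_add (mul_le_mul_right ((setLIntegral_le_lintegral _ _).trans hL_s) 2)
            (mul_le_mul_right hA 2)
      _ = ENNReal.ofReal (2 * (δ * (Real.sqrt θ * r)) + 2 * (C ^ 2 / (θ * r ^ 2) * r ^ 3 * V)) :=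
          two_mul_ofReal_add (by positivity) (by positivity)
      _ = ENNReal.ofReal ((2 * δ * Real.sqrt θ + 2 * W) * r) := by
          congr 1
          rw [hWdef]
          field_simp
  have hAε : 2 * δ * Real.sqrt θ + 2 * W ≤ ε / 4 := by linarith
  -- (d) the two cases `t = T` and `t < T`
  rcases ht.2.eq_or_lt with rfl | htT
  · calc ∫⁻ x in ball x₀ r, ‖u t x‖ₑ ^ 2 ≤ ENNReal.ofReal ((2 * δ * Real.sqrt θ + 2 * W) * r) := hB
      _ ≤ ENNReal.ofReal (ε * r) :=
          ENNReal.ofReal_le_ofReal (mul_le_mul_of_nonneg_right (by linarith) hr.le)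
  · have ht₁ : T₁ < t := by
      have : T - θ * r ^ 2 ≤ T - r ^ 2 := by nlinarith [sq_nonneg r]
      linarith [ht.1, hsI.1]
    obtain ⟨-, hDt, ht0T⟩ := hT₁ ⟨ht₁, htT⟩
    have hmt : MemLp (u t) 2 volume := hLH.memLp t ⟨ht0T.1.le, ht0T.2.le⟩
    have hTt : 0 < T - t := sub_pos.2 htT
    have hsqt : Real.sqrt (T - t) < r := by
      calc Real.sqrt (T - t) < Real.sqrt (r ^ 2) := Real.sqrt_lt_sqrt hTt.le (by linarith [ht.1])
        _ = r := Real.sqrt_sq hr.le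
    have hsqt0 : 0 < Real.sqrt (T - t) := Real.sqrt_pos.2 hTt
    have hI_t : ∫ x, ‖u t x - u T x‖ ^ 2 ≤ δ * r := by
      have h := mul_lt_mul_of_pos_left hDt hsqt0
      rw [← mul_assoc, mul_inv_cancel₀ hsqt0.ne', one_mul] at h
      have h' : Real.sqrt (T - t) * δ ≤ r * δ := mul_le_mul_of_nonneg_right hsqt.le hδ0.le
      linarith
    have hL_t : ∫⁻ x, ‖u t x - u T x‖ₑ ^ 2 ≤ ENNReal.ofReal (δ * r) := by
      rw [lintegral_enorm_sq_eq_ofReal (f := fun x => u t x - u T x) (hmt.sub hmT)]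
      exact ENNReal.ofReal_le_ofReal hI_t
    have hsum : 2 * δ + 2 * (2 * δ * Real.sqrt θ + 2 * W) ≤ ε := by linarith
    calc ∫⁻ x in ball x₀ r, ‖u t x‖ₑ ^ 2
        ≤ 2 * (∫⁻ x in ball x₀ r, ‖u t x - u T x‖ₑ ^ 2) + 2 * ∫⁻ x in ball x₀ r, ‖u T x‖ₑ ^ 2 :=
          setLIntegral_enorm_sq_le hmT.1 _
      _ ≤ 2 * ENNReal.ofReal (δ * r) + 2 * ENNReal.ofReal ((2 * δ * Real.sqrt θ + 2 * W) * r) :=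
          add_le_add (mul_le_mul_right ((setLIntegral_le_lintegral _ _).trans hL_t) 2)
            (mul_le_mul_right hB 2)
      _ = ENNReal.ofReal (2 * (δ * r) + 2 * ((2 * δ * Real.sqrt θ + 2 * W) * r)) :=
          two_mul_ofReal_add (by positivity) (by positivity)
      _ ≤ ENNReal.ofReal (ε * r) := by
          refine ENNReal.ofReal_le_ofReal ?_
          calc 2 * (δ * r) + 2 * ((2 * δ * Real.sqrt θ + 2 * W) * r)
              = (2 * δ + 2 * (2 * δ * Real.sqrt θ + 2 * W)) * r := by ring
            _ ≤ ε * r := mul_le_mul_of_nonneg_right hsum hr.le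

end JoltFlatCell

open JoltFlatCell in
/-- **Item stmt-NavierStokesRegularity-26464** (`QuarterJolt.JoltFlatCell`), BY NAME: in the frame (classical on `[0,T)`,
Leray–Hopf on `[0,T]`, rapidly decaying datum), the quarter slice law with constant `K` and no terminal jolt
`(√(T−t))⁻¹‖u(t)−u(T)‖₂² → 0` give, at every `x₀`, a vanishing scaled cell energy
`∀ ε > 0 ∃ r₀ > 0 ∀ r ∈ (0,r₀) ∀ t ∈ (T−r², T]: ∫_{B_r(x₀)}|u(t)|² ≤ ε r`.  An unconditional support; nothing about NS
regularity is asserted (the cruxes `EnstrophyQuarterLaw`, `NoTerminalJolt` stay open). [folklore] -/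
theorem joltFlatCell_proof :
    Summit.NavierStokesRegularity.NavierStokesRegularity.Theses.QuarterJolt.JoltFlatCell := by
  unfold Summit.NavierStokesRegularity.NavierStokesRegularity.Theses.QuarterJolt.JoltFlatCell
  intro ν T hν hT u p hsol hLH hdec K hK hJ x₀ ε hε
  exact main hν hT hsol hLH hdec K hK hJ x₀ hε

end Summit.NavierStokesRegularity.NavierStokesRegularity.Theorems

end
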